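import Literature.MathematicalPhysics.QuantumFieldTheory.ConformalBootstrap3D.MixedOddHead
import Literature.MathematicalPhysics.QuantumFieldTheory.ConformalBootstrap3D.MixedEvenHead

/-!
# The mixed `σ–ε` point certificate as a finite table of numbers

Assembly of `MixedEvenTail` (identity (I), even tail (M)/(T)), `MixedEvenHead` (even light-block
cells (E2)–(E4)), `MixedOddTail` (odd tail (M_odd)/(T_odd)) and `MixedOddHead` (odd light-block cells
(D2)–(D4)) into ONE theorem whose hypotheses are a finite table of closed-form real numbers and
order relations between table breakpoints — the format an engineer's transcript instantiates and a
checker re-evaluates twice (`boxExcluded_of_mixedPointTable`). Data: nodes `(z_k, z̄_k)` in the open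
square with `z̄_k ≤ z_k`, a 5-row weight table `w`, an apex `a₀` with domination ratios `qd, qr`, the
box `Q ⊆ [σ_lo,σ_hi] × [ε_lo,ε_hi]`, the `c`-box `[c₁,c₂] ∋ (Δ_σ-Δ_ε)/2`, thresholds `E₀ > 1`,
`E_T`, twist parameter `τ ≤ min(1, E₀)`, a spin cutoff `L` with `L + 1 ≥ E₀`; per sector and row a
list of `Δ`-cells (breakpoints `t`, count `K`, head levels `n_F`) with their numbers, per sector the
(M) box rows (breakpoints `e`, counts `M`) with their numbers, and the apex checks. CONCLUSION:
`BoxExcluded Q` — no unitary mixed `σ–ε` system (A1–A4) has `(Δ_σ, Δ_ε) ∈ Q`.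
[cite: KosPolandSimmonsduffin2014, §3.3 eq. (3.16)]
-/

noncomputable section

namespace Literature.MathematicalPhysics.QuantumFieldTheory.ConformalBootstrap3D

open Finset Set Filter Topology

/-- Discrete intermediate-value step: a point between the first and the last breakpoint lies in one
of the half-open cells (no monotonicity needed). [folklore] -/
theorem exists_Ico_of_breakpoints (t : ℕ → ℝ) (m : ℕ) {x : ℝ} (h0 : t 0 ≤ x) (hm : x < t m) :
    ∃ i, i < m ∧ x ∈ Ico (t i) (t (i + 1)) := by
  by_contra hne
  push Not at hne
  have key : ∀ i, i ≤ m → t i ≤ x := by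
    intro i
    induction i with
    | zero => intro _; exact h0
    | succ i ih =>
      intro hi'
      have h1 := ih (by omega)
      by_contra hlt
      exact hne i (by omega) ⟨h1, not_le.1 hlt⟩
  exact absurd (key m le_rfl) (not_le.2 hm)

/-! ### The (M) rows from box tables -/

/-- **Even (M) rows from a box table.** For every `j` with `j + τ < E_T`, breakpoints
`e j 0 ≤ max(E₀, j+τ)`, `e j (M j) ≥ E_T` and, per box, the three corner numbers of
`evenTermForm_nonneg_of_cornerBounds`; then every even term form with `E ∈ [E₀, E_T)`, `j + τ ≤ E`
is PSD on `Q`. [cite: KosPolandSimmonsduffin2014, §3.3 eq. (3.16)] -/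
theorem ruleM_even_of_boxTable {N : ℕ} (z zb : Fin N → ℝ) (w : Fin 5 → Fin N → ℝ)
    (hz : ∀ k, z k ∈ Ioo (0 : ℝ) 1) (hzb : ∀ k, zb k ∈ Ioo (0 : ℝ) 1)
    {Q : Set (ℝ × ℝ)} {σlo σhi εlo εhi E₀ ET τ : ℝ}
    (hQ : ∀ p ∈ Q, (σlo ≤ p.1 ∧ p.1 ≤ σhi) ∧ (εlo ≤ p.2 ∧ p.2 ≤ εhi))
    (e : ℕ → ℕ → ℝ) (M : ℕ → ℕ)
    (he : ∀ j : ℕ, (j : ℝ) + τ < ET → e j 0 ≤ max E₀ ((j : ℝ) + τ) ∧ ET ≤ e j (M j))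
    (hbox : ∀ j : ℕ, (j : ℝ) + τ < ET → ∀ m < M j,
      0 ≤ termCornerBound (w 0) z zb j (e j m) (e j (m + 1)) σlo σhi ∧
      0 ≤ termCornerBound (w 1) z zb j (e j m) (e j (m + 1)) εlo εhi ∧
      offDiagTermAbs z zb w j (e j m) (e j (m + 1)) ((σlo + εlo) / 2) ((σhi + εhi) / 2) ^ 2 ≤
        4 * termCornerBound (w 0) z zb j (e j m) (e j (m + 1)) σlo σhi *
          termCornerBound (w 1) z zb j (e j m) (e j (m + 1)) εlo εhi) :
    ∀ (j : ℕ) (E : ℝ), E₀ ≤ E → E < ET → (j : ℝ) + τ ≤ E → ∀ p ∈ Q,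
      ∀ x y : ℝ, 0 ≤ evenTermForm z zb w p.1 p.2 E j x y := by
  intro j E hE0 hET hjE p hp x y
  have hjT : (j : ℝ) + τ < ET := lt_of_le_of_lt hjE hET
  obtain ⟨he0, heM⟩ := he j hjT
  have h0 : e j 0 ≤ E := he0.trans (max_le hE0 hjE)
  obtain ⟨m, hm, hEm⟩ := exists_Ico_of_breakpoints (e j) (M j) h0 (lt_of_lt_of_le hET heM)
  obtain ⟨hX, hY, hZ⟩ := hbox j hjT m hm
  exact evenTermForm_nonneg_of_cornerBounds z zb w hz hzb j hX hY hZ E ⟨hEm.1, hEm.2.le⟩ p.1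
    ⟨(hQ p hp).1.1, (hQ p hp).1.2⟩ p.2 ⟨(hQ p hp).2.1, (hQ p hp).2.2⟩ x y

/-- **Odd (M_odd) rows from a box table**: per box one number
`cornerBound₂ (w⁴-w⁵-|w³|) (w⁴+w⁵+|w³|) j e_m e_{m+1} σ_lo σ_hi ≥ 0`.
[cite: KosPolandSimmonsduffin2014, §3.3 eq. (3.16)] -/
theorem ruleM_odd_of_boxTable {N : ℕ} (z zb : Fin N → ℝ) (w : Fin 5 → Fin N → ℝ)
    (hz : ∀ k, z k ∈ Ioo (0 : ℝ) 1) (hzb : ∀ k, zb k ∈ Ioo (0 : ℝ) 1)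
    {Q : Set (ℝ × ℝ)} {σlo σhi εlo εhi E₀ ET τ : ℝ}
    (hQ : ∀ p ∈ Q, (σlo ≤ p.1 ∧ p.1 ≤ σhi) ∧ (εlo ≤ p.2 ∧ p.2 ≤ εhi))
    (e : ℕ → ℕ → ℝ) (M : ℕ → ℕ)
    (he : ∀ j : ℕ, (j : ℝ) + τ < ET → e j 0 ≤ max E₀ ((j : ℝ) + τ) ∧ ET ≤ e j (M j))
    (hbox : ∀ j : ℕ, (j : ℝ) + τ < ET → ∀ m < M j,
      0 ≤ cornerBound₂ (fun k => w 3 k - w 4 k - |w 2 k|) (fun k => w 3 k + w 4 k + |w 2 k|) z zb j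
        (e j m) (e j (m + 1)) σlo σhi) :
    ∀ (j : ℕ) (E : ℝ), E₀ ≤ E → E < ET → (j : ℝ) + τ ≤ E → ∀ p ∈ Q,
      0 ≤ oddDomEval z zb w p.1 (zMono E j) := by
  intro j E hE0 hET hjE p hp
  have hjT : (j : ℝ) + τ < ET := lt_of_le_of_lt hjE hET
  obtain ⟨he0, heM⟩ := he j hjT
  have h0 : e j 0 ≤ E := he0.trans (max_le hE0 hjE)
  obtain ⟨m, hm, hEm⟩ := exists_Ico_of_breakpoints (e j) (M j) h0 (lt_of_lt_of_le hET heM)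
  exact oddDomEval_nonneg_of_cornerBound₂ z zb w hz hzb j (hbox j hjT m hm) ⟨hEm.1, hEm.2.le⟩
    ⟨(hQ p hp).1.1, (hQ p hp).1.2⟩

/-! ### The table theorem -/

/-- **Exclusion of a box `Q` of `(Δ_σ, Δ_ε)` from a finite table of numbers (mixed `σ–ε` system).**
HYPOTHESES, all closed-form in the data: nodes in the open square with `z̄_k ≤ z_k`; apex domination
ratios; `Q ⊆ [σ_lo,σ_hi] × [ε_lo,ε_hi]` with `(Δ_σ-Δ_ε)/2 ∈ [c₁,c₂]` on `Q`; `τ ≤ 1`, `τ ≤ E₀`,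
`1 < E₀ ≤ L + 1`; (I) the identity corner number `> 0`; EVEN CELLS — the `ε`-row (`ℓ = 0`,
breakpoints `tε` covering `[ε_lo, ε_hi]`), the scalar row (`ℓ = 0`, from `≤ 3` to `E₀`) and the even-spin
rows `0 < ℓ < L` (from `ℓ+1` to `E₀`), each cell starting strictly above the unitarity bound and at
`≥ ℓ + τ`, with head level `n_F` (`start + n_F + 1 ≥ E₀`) and the three numbers `X_lo ≥ 0`,
`Y_lo ≥ 0`, `Z_abs² ≤ 4 X_lo Y_lo`; EVEN (M) box rows (three corner numbers per box) and the even
apex checks; ODD CELLS — the `σ`-row (`ℓ = 0`, breakpoints `tσ` covering `[σ_lo, σ_hi]`, last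
breakpoint `≤ 1`), the odd scalar row (`ℓ = 0`, from `≤ 3` to `E₀`, first breakpoint `> 1`) and the
odd rows of EVERY spin `0 < ℓ < L` (from `ℓ+1` to `E₀`), each cell with one number
`oddHeadNumber ≥ 0`; ODD (M_odd) box rows (one number per box) and the odd apex checks.
CONCLUSION: `BoxExcluded Q`. [cite: KosPolandSimmonsduffin2014, §3.3 eq. (3.16)] -/
theorem boxExcluded_of_mixedPointTable {N : ℕ} {z zb : Fin N → ℝ} {w : Fin 5 → Fin N → ℝ}
    (hz : ∀ k, z k ∈ Ioo (0 : ℝ) 1) (hzb : ∀ k, zb k ∈ Ioo (0 : ℝ) 1) (hord : ∀ k, zb k ≤ z k)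
    (a₀ : Fin N) (qd qr : Fin N → ℝ) (hqd : ∀ k, 0 < qd k ∧ qd k ≤ 1)
    (hqr : ∀ k, 0 < qr k ∧ qr k ≤ 1)
    (hdomd : ∀ k, z k * zb k ≤ qd k ^ 2 * (z a₀ * zb a₀) ∧ z k ≤ qd k * z a₀)
    (hdomr : ∀ k, (1 - z k) * (1 - zb k) ≤ qr k ^ 2 * (z a₀ * zb a₀) ∧ 1 - zb k ≤ qr k * z a₀)
    {Q : Set (ℝ × ℝ)} {σlo σhi εlo εhi c₁ c₂ E₀ ET τ : ℝ}
    (hQ : ∀ p ∈ Q, (σlo ≤ p.1 ∧ p.1 ≤ σhi) ∧ (εlo ≤ p.2 ∧ p.2 ≤ εhi))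
    (hQc : ∀ p ∈ Q, c₁ ≤ (p.1 - p.2) / 2 ∧ (p.1 - p.2) / 2 ≤ c₂)
    (hτ1 : τ ≤ 1) (hτ0 : τ ≤ E₀) (hE1 : 1 < E₀) (L : ℕ) (hL : E₀ ≤ (L : ℝ) + 1)
    -- (I)
    (hI : 0 < termCornerBound (w 0) z zb 0 0 0 σlo σhi + termCornerBound (w 1) z zb 0 0 0 εlo εhi +
      cornerBound₂ (w 3 + w 4) (w 3 - w 4) z zb 0 0 0 ((σlo + εlo) / 2) ((σhi + εhi) / 2))
    -- EVEN CELLS: ε-row, scalar + even-spin rows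
    (tε : ℕ → ℝ) (Kε : ℕ) (nFε : ℕ → ℕ) (htε : tε 0 ≤ εlo ∧ εhi < tε Kε)
    (hlowε : ∀ k, k < Kε → 1 / 2 < tε k ∧ τ ≤ tε k)
    (hnFε : ∀ k, k < Kε → E₀ ≤ tε k + ((nFε k : ℝ) + 1))
    (hcellε : ∀ k, k < Kε → 0 ≤ evenHeadX z zb w 0 (tε k) (tε (k + 1)) σlo σhi (nFε k) ∧
      0 ≤ evenHeadY z zb w 0 (tε k) (tε (k + 1)) εlo εhi (nFε k) ∧
      evenHeadZ z zb w 0 (tε k) (tε (k + 1)) σlo σhi εlo εhi (nFε k) ^ 2 ≤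
        4 * evenHeadX z zb w 0 (tε k) (tε (k + 1)) σlo σhi (nFε k) *
          evenHeadY z zb w 0 (tε k) (tε (k + 1)) εlo εhi (nFε k))
    (te : ℕ → ℕ → ℝ) (Ke : ℕ → ℕ) (nFe : ℕ → ℕ → ℕ)
    (hte0 : te 0 0 ≤ 3 ∧ te 0 (Ke 0) = E₀)
    (hteℓ : ∀ ℓ, Even ℓ → ℓ ≠ 0 → ℓ < L → te ℓ 0 ≤ (ℓ : ℝ) + 1 ∧ te ℓ (Ke ℓ) = E₀)
    (hlowe : ∀ ℓ k, k < Ke ℓ → unitarityBound3D ℓ < te ℓ k ∧ (ℓ : ℝ) + τ ≤ te ℓ k)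
    (hnFe : ∀ ℓ k, k < Ke ℓ → E₀ ≤ te ℓ k + ((nFe ℓ k : ℝ) + 1))
    (hcelle : ∀ ℓ, (ℓ = 0 ∨ (Even ℓ ∧ ℓ < L)) → ∀ k, k < Ke ℓ →
      0 ≤ evenHeadX z zb w ℓ (te ℓ k) (te ℓ (k + 1)) σlo σhi (nFe ℓ k) ∧
      0 ≤ evenHeadY z zb w ℓ (te ℓ k) (te ℓ (k + 1)) εlo εhi (nFe ℓ k) ∧
      evenHeadZ z zb w ℓ (te ℓ k) (te ℓ (k + 1)) σlo σhi εlo εhi (nFe ℓ k) ^ 2 ≤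
        4 * evenHeadX z zb w ℓ (te ℓ k) (te ℓ (k + 1)) σlo σhi (nFe ℓ k) *
          evenHeadY z zb w ℓ (te ℓ k) (te ℓ (k + 1)) εlo εhi (nFe ℓ k))
    -- EVEN (M) box rows and (T)
    (ee : ℕ → ℕ → ℝ) (Me : ℕ → ℕ)
    (hee : ∀ j : ℕ, (j : ℝ) + τ < ET → ee j 0 ≤ max E₀ ((j : ℝ) + τ) ∧ ET ≤ ee j (Me j))
    (hboxe : ∀ j : ℕ, (j : ℝ) + τ < ET → ∀ m < Me j,
      0 ≤ termCornerBound (w 0) z zb j (ee j m) (ee j (m + 1)) σlo σhi ∧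
      0 ≤ termCornerBound (w 1) z zb j (ee j m) (ee j (m + 1)) εlo εhi ∧
      offDiagTermAbs z zb w j (ee j m) (ee j (m + 1)) ((σlo + εlo) / 2) ((σhi + εhi) / 2) ^ 2 ≤
        4 * termCornerBound (w 0) z zb j (ee j m) (ee j (m + 1)) σlo σhi *
          termCornerBound (w 1) z zb j (ee j m) (ee j (m + 1)) εlo εhi)
    (h0 : 0 ≤ w 0 a₀) (h1 : 0 ≤ w 1 a₀)
    (hX0 : 0 ≤ w 0 a₀ * ((1 - z a₀) * (1 - zb a₀)) ^ σhi - apexRest (w 0) z zb a₀ qd qr σlo ET)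
    (hY0 : 0 ≤ w 1 a₀ * ((1 - z a₀) * (1 - zb a₀)) ^ εhi - apexRest (w 1) z zb a₀ qd qr εlo ET)
    (hZ0 : (|w 3 a₀ + w 4 a₀| * ((1 - z a₀) * (1 - zb a₀)) ^ ((σlo + εlo) / 2)
            + apexRest (w 3) z zb a₀ qd qr ((σlo + εlo) / 2) ET
            + apexRest (w 4) z zb a₀ qd qr ((σlo + εlo) / 2) ET) ^ 2 ≤
        4 * (w 0 a₀ * ((1 - z a₀) * (1 - zb a₀)) ^ σhi - apexRest (w 0) z zb a₀ qd qr σlo ET) *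
          (w 1 a₀ * ((1 - z a₀) * (1 - zb a₀)) ^ εhi - apexRest (w 1) z zb a₀ qd qr εlo ET))
    -- ODD CELLS: σ-row, scalar + all-spin rows
    (tσ : ℕ → ℝ) (Kσ : ℕ) (nFσ : ℕ → ℕ) (htσ : tσ 0 ≤ σlo ∧ σhi < tσ Kσ)
    (hlowσ : ∀ k, k < Kσ → 1 / 2 < tσ k ∧ τ ≤ tσ k ∧ tσ (k + 1) ≤ 1)
    (hnFσ : ∀ k, k < Kσ → E₀ ≤ tσ k + ((nFσ k : ℝ) + 1))
    (hcellσ : ∀ k, k < Kσ → 0 ≤ oddHeadNumber z zb w 0 c₁ c₂ (tσ k) (tσ (k + 1)) σlo σhi (nFσ k))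
    (td : ℕ → ℕ → ℝ) (Ko : ℕ → ℕ) (nFo : ℕ → ℕ → ℕ)
    (htd0 : td 0 0 ≤ 3 ∧ td 0 (Ko 0) = E₀ ∧ 1 < td 0 0)
    (htdℓ : ∀ ℓ, ℓ ≠ 0 → ℓ < L → td ℓ 0 ≤ (ℓ : ℝ) + 1 ∧ td ℓ (Ko ℓ) = E₀)
    (hlowo : ∀ ℓ k, k < Ko ℓ → unitarityBound3D ℓ < td ℓ k ∧ (ℓ : ℝ) + τ ≤ td ℓ k ∧ td ℓ 0 ≤ td ℓ k)
    (hnFo : ∀ ℓ k, k < Ko ℓ → E₀ ≤ td ℓ k + ((nFo ℓ k : ℝ) + 1))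
    (hcello : ∀ ℓ, ℓ < L → ∀ k, k < Ko ℓ →
      0 ≤ oddHeadNumber z zb w ℓ c₁ c₂ (td ℓ k) (td ℓ (k + 1)) σlo σhi (nFo ℓ k))
    -- ODD (M_odd) box rows and (T_odd)
    (eo : ℕ → ℕ → ℝ) (Mo : ℕ → ℕ)
    (heo : ∀ j : ℕ, (j : ℝ) + τ < ET → eo j 0 ≤ max E₀ ((j : ℝ) + τ) ∧ ET ≤ eo j (Mo j))
    (hboxo : ∀ j : ℕ, (j : ℝ) + τ < ET → ∀ m < Mo j,
      0 ≤ cornerBound₂ (fun k => w 3 k - w 4 k - |w 2 k|) (fun k => w 3 k + w 4 k + |w 2 k|) z zb j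
        (eo j m) (eo j (m + 1)) σlo σhi)
    (hc : 0 ≤ w 3 a₀ - w 4 a₀ - |w 2 a₀|)
    (hTodd : apexRest (w 3) z zb a₀ qd qr σlo ET + apexRest (w 4) z zb a₀ qd qr σlo ET +
        apexRest (fun k => |w 2 k|) z zb a₀ qd qr σlo ET ≤
      (w 3 a₀ - w 4 a₀ - |w 2 a₀|) * ((1 - z a₀) * (1 - zb a₀)) ^ σhi) :
    BoxExcluded Q := by
  -- the (M) rows
  have hM := ruleM_even_of_boxTable z zb w hz hzb hQ ee Me hee hboxe
  have hModd := ruleM_odd_of_boxTable z zb w hz hzb hQ eo Mo heo hboxo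
  -- even cells
  have hcelle' : ∀ ℓ, (ℓ = 0 ∨ (Even ℓ ∧ ℓ < L)) → ∀ k, k < Ke ℓ → ∀ p ∈ Q,
      ∀ Δ ∈ Ico (te ℓ k) (te ℓ (k + 1)),
        (CrossingFunctional.ofPoints z zb w).EvenPositive p.1 p.2 Δ ℓ := by
    intro ℓ hℓ k hk
    obtain ⟨hX, hY, hZ⟩ := hcelle ℓ hℓ k hk
    exact evenCell_of_headNumbers z zb w hz hzb hord a₀ qd qr hqd hqr hdomd hdomr hQ hM h0 h1 hX0 hY0
      hZ0 (hlowe ℓ k hk).1 (hlowe ℓ k hk).2 (nFe ℓ k) (hnFe ℓ k hk) hX hY hZ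
  have hb0 : unitarityBound3D 0 = 1 / 2 := by simp [unitarityBound3D]
  have hcellε' : ∀ k, k < Kε → ∀ p ∈ Q, ∀ Δ ∈ Ico (tε k) (tε (k + 1)),
      (CrossingFunctional.ofPoints z zb w).EvenPositive p.1 p.2 Δ 0 := by
    intro k hk
    obtain ⟨hX, hY, hZ⟩ := hcellε k hk
    refine evenCell_of_headNumbers z zb w hz hzb hord a₀ qd qr hqd hqr hdomd hdomr hQ hM h0 h1 hX0
      hY0 hZ0 (by rw [hb0]; exact (hlowε k hk).1) (by simpa using (hlowε k hk).2) (nFε k)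
      (hnFε k hk) hX hY hZ
  -- odd cells
  have hcello' : ∀ ℓ, ℓ < L → ∀ k, k < Ko ℓ → ∀ p ∈ Q, ∀ Δ ∈ Ico (td ℓ k) (td ℓ (k + 1)),
      (CrossingFunctional.ofPoints z zb w).OddPositive p.1 p.2 Δ ℓ := by
    intro ℓ hℓ k hk
    refine oddCell_of_headNumber z zb w hz hzb hord a₀ qd qr hqd hqr hdomd hdomr hQ hQc hModd hc hTodd
      (hlowo ℓ k hk).1 (hlowo ℓ k hk).2.1 ?_ (nFo ℓ k) (hnFo ℓ k hk) (hcello ℓ hℓ k hk)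
    intro hℓ0
    subst hℓ0
    exact Or.inl (lt_of_lt_of_le htd0.2.2 (hlowo 0 k hk).2.2)
  have hcellσ' : ∀ k, k < Kσ → ∀ p ∈ Q, ∀ Δ ∈ Ico (tσ k) (tσ (k + 1)),
      (CrossingFunctional.ofPoints z zb w).OddPositive p.1 p.2 Δ 0 := by
    intro k hk
    refine oddCell_of_headNumber z zb w hz hzb hord a₀ qd qr hqd hqr hdomd hdomr hQ hQc hModd hc hTodd
      (by rw [hb0]; exact (hlowσ k hk).1) (by simpa using (hlowσ k hk).2.1)
      (fun _ => Or.inr (hlowσ k hk).2.2) (nFσ k) (hnFσ k hk) (hcellσ k hk)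
  have hL0 : 0 < L := by
    by_contra h
    have : L = 0 := by omega
    subst this
    simp at hL
    linarith
  refine boxExcluded_of_mixedPointRules₂ hz hzb hord a₀ qd qr hqd hqr hdomd hdomr hQ hτ1 hτ0 hE1 hI
    ?_ ?_ ?_ hM h0 h1 hX0 hY0 hZ0 ?_ ?_ ?_ hModd hc hTodd
  · -- (E2): `Δ_ε` lies in the ε-row
    intro p hp
    exact evenPositive_of_cells z zb w tε Kε htε.1 le_rfl hcellε' p hp p.2 (hQ p hp).2.1
      (lt_of_le_of_lt (hQ p hp).2.2 htε.2)
  · -- (E3)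
    intro p hp Δ h3 hΔ
    exact evenPositive_of_cells z zb w (te 0) (Ke 0) hte0.1 hte0.2.symm.le (hcelle' 0 (Or.inl rfl)) p hp
      Δ h3 hΔ
  · -- (E4)
    intro p hp ℓ hev hℓ Δ hℓΔ hΔ
    have hℓL : ℓ < L := by
      by_contra h
      have : (L : ℝ) ≤ ℓ := by exact_mod_cast not_lt.1 h
      linarith
    obtain ⟨hlo, hhi⟩ := hteℓ ℓ hev hℓ hℓL
    exact evenPositive_of_cells z zb w (te ℓ) (Ke ℓ) hlo hhi.symm.le (hcelle' ℓ (Or.inr ⟨hev, hℓL⟩))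
      p hp Δ hℓΔ hΔ
  · -- (D2): `Δ_σ` lies in the σ-row
    intro p hp
    exact oddPositive_of_cells z zb w tσ Kσ htσ.1 le_rfl hcellσ' p hp p.1 (hQ p hp).1.1
      (lt_of_le_of_lt (hQ p hp).1.2 htσ.2)
  · -- (D3)
    intro p hp Δ h3 hΔ
    exact oddPositive_of_cells z zb w (td 0) (Ko 0) htd0.1 htd0.2.1.symm.le (hcello' 0 hL0) p hp Δ h3 hΔ
  · -- (D4)
    intro p hp ℓ hℓ Δ hℓΔ hΔ
    have hℓL : ℓ < L := by
      by_contra h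
      have : (L : ℝ) ≤ ℓ := by exact_mod_cast not_lt.1 h
      linarith
    obtain ⟨hlo, hhi⟩ := htdℓ ℓ hℓ hℓL
    exact oddPositive_of_cells z zb w (td ℓ) (Ko ℓ) hlo hhi.symm.le (hcello' ℓ hℓL) p hp Δ hℓΔ hΔ

end Literature.MathematicalPhysics.QuantumFieldTheory.ConformalBootstrap3D
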